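import Literature.AlgebraicGeometry.Resolution.QuadraticTransformsRegular
import Literature.AlgebraicGeometry.Resolution.SymbolicPowersRsop
import HarnessLib

/-!
# Monoidal transforms of a regular local ring are regular ([CoP1] §8, "monoidal transform at `(yᵢ, yⱼ)` along `W`")

Topic: `Literature/AlgebraicGeometry/Resolution`. PROOF side of `CossartPiltant2019ReductionP`
(`ArithmeticalThreefoldsLocal.lean`), input (C4): the geometric head of the decomposition layer
of [CoP1] Prop. 9.3 is [CoP1] Prop. 8.1 (`exists_localUniformization_of_head'`,
`DecompositionLayerStrictParameters.lean`), whose printed proof (HAL pp. 22–24) modifies a local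
uniformization `S₂` with regular system of parameters `(y₁, y₂, y₃)` by **monoidal transforms
along the valuation**: "Let `S₂⁽¹⁾` be the monoidal transform at `(y_{i₁}, y_{i₂})` of `S₂`
along `W`. If `W y_{i₂} ≥ W y_{i₁}`, then `(y_{i₃}, y_{i₁}, P(y_{i₂}/y_{i₁}))` is a r.s.p. of
`S₂⁽¹⁾`" (p. 23), and Lemma 8.2 (Perron) iterates such transforms. This file provides the
regularity of these transforms in the tree's currency (subrings of a field `K`, `locAtCentre`):

* (tree, `SymbolicPowersRsop.lean`) `isQuasiRegular_rsop_comp` — a sub-family `x ∘ e`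
  (`e` injective) of a regular system of parameters is quasi-regular;
* `isRegularRing_closure_monoidalChart` — **the chart `R[xⱼ/xᵢ : j ∈ J]` (`i ∈ J`) of the
  blowing up of `Spec R` along the regular centre `V(xⱼ : j ∈ J)` is a regular ring**
  (`isRegularRing_blowupChart` + `isRegularRing_closure_of_isRegularRing_blowupChart`);
* `isRegularLocalRing_locAtCentre_monoidalChart` — **the monoidal transform along a valuation
  ring `O ⊇ R`** (the local ring of that chart at the centre of `O`, for `xᵢ` of least value
  among the `xⱼ`, `j ∈ J`) **is a regular local ring**.

Everything is PROVED; no named facts, definitions, instances or notation are introduced.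

## Sources

* V. Cossart, O. Piltant, J. Algebra 320 (2008) 1051–1082: proof of Prop. 8.1 and Lemma 8.2
  (HAL hal-00139124, pp. 22–24). [CossartPiltant2008]
* Q. Liu, *Algebraic Geometry and Arithmetic Curves*, Thm. 8.1.19 (a). [Liu2002]
-/

noncomputable section

namespace Literature.AlgebraicGeometry.Resolution

universe u

open IsLocalRing


section Chart

variable {K : Type u} [Field K]

/-- **The chart of the blowing up of a regular local ring along part of a regular system of
parameters is a regular ring**: for `R ⊆ K` regular local with regular system of parameters
`x`, an injective `e : Fin m → Fin d` and `i`, the subring `R[x_{e j}/x_{e i} : j] ⊆ K` is a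
regular ring (Liu Thm. 8.1.19 (a) for the regular centre `V(x_{e j} : j)`, through the tree's
`isRegularRing_blowupChart`). [cite: Liu2002, Thm. 8.1.19 (a)]
[cite: CossartPiltant2008, proof of Prop. 8.1 (HAL p. 23), monoidal transforms] -/
theorem isRegularRing_closure_monoidalChart (R : Subring K) [IsRegularLocalRing R] {d : ℕ}
    (hd : (maximalIdeal R).spanFinrank = d) (x : Fin d → R)
    (hx : Ideal.span (Set.range x) = maximalIdeal R) {m : ℕ} (e : Fin m → Fin d)
    (he : Function.Injective e) (i : Fin m) :
    IsRegularRing (Subring.closure ((R : Set K) ∪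
      Set.range fun j : Fin m => (x (e j) : K) / (x (e i) : K))) := by
  classical
  set y : Fin m → R := x ∘ e with hy
  have hyi : y i ≠ 0 := by
    intro h
    have hnot : e i ∉ (∅ : Set (Fin d)) := Set.notMem_empty _
    have := not_mem_span_image_of_not_mem hd x hx hnot
    rw [Set.image_empty, Ideal.span_empty] at this
    exact this (by rw [show x (e i) = y i from rfl, h]; exact Submodule.zero_mem ⊥)
  haveI : IsRegularRing R := isRegularRing_of_isRegularLocalRing R
  haveI : IsRegularRing (R ⧸ Ideal.span (Set.range y)) := by
    have hrange : Set.range y = x '' ((Finset.univ.image e : Finset (Fin d)) : Set (Fin d)) := by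
      rw [hy, Set.range_comp, Finset.coe_image, Finset.coe_univ, Set.image_univ]
    have hreg : IsRegularLocalRing (R ⧸ Ideal.span (x '' ((Finset.univ.image e :
        Finset (Fin d)) : Set (Fin d)))) :=
      isRegularLocalRing_quotient_span_image hd x hx _
    rw [← hrange] at hreg
    exact isRegularRing_of_isRegularLocalRing _
  have hB := isRegularRing_blowupChart y i (isQuasiRegular_rsop_comp hd x hx e he)
  have hyi' : R.subtype (y i) ≠ 0 := fun h => hyi (Subtype.ext h)
  have hreg := isRegularRing_closure_of_isRegularRing_blowupChart R.subtype y i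
    Subtype.val_injective hyi' hB
  have hset : ((R.subtype.range : Set K) ∪ Set.range fun j => R.subtype (y j) / R.subtype (y i)) =
      (R : Set K) ∪ Set.range fun j : Fin m => (x (e j) : K) / (x (e i) : K) := by
    rw [Subring.range_subtype]
    rfl
  rw [← hset]
  exact hreg

/-- **The monoidal transform of a regular local ring along a valuation is a regular local
ring** ([CoP1] proof of Prop. 8.1, HAL p. 23: "`S₂⁽¹⁾` … is a r.s.p. of `S₂⁽¹⁾`"): for `R ⊆ O`
regular local with regular system of parameters `x`, a sub-family `x ∘ e` (the regular centre)
and `i` with `v(x_{e i}) ≤ v(x_{e j})` for all `j` (the chart containing the centre of `O`), the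
local ring `locAtCentre R[x_{e j}/x_{e i} : j] O` is a regular local ring.
[cite: CossartPiltant2008, proof of Prop. 8.1 (HAL p. 23)] [cite: Liu2002, Thm. 8.1.19 (a)] -/
theorem isRegularLocalRing_locAtCentre_monoidalChart (R : Subring K) [IsRegularLocalRing R]
    {d : ℕ} (hd : (maximalIdeal R).spanFinrank = d) (x : Fin d → R)
    (hx : Ideal.span (Set.range x) = maximalIdeal R) {m : ℕ} (e : Fin m → Fin d)
    (he : Function.Injective e) (i : Fin m) (O : ValuationSubring K) (hRO : R ≤ O.toSubring)
    (hmin : ∀ j : Fin m, O.valuation (x (e j) : K) ≤ O.valuation (x (e i) : K)) :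
    IsRegularLocalRing (locAtCentre (Subring.closure ((R : Set K) ∪
      Set.range fun j : Fin m => (x (e j) : K) / (x (e i) : K))) O) := by
  classical
  haveI := isRegularRing_closure_monoidalChart R hd x hx e he i
  refine isRegularLocalRing_locAtCentre_of_isRegularRing (Subring.closure_le.mpr ?_)
  rintro z (hz | ⟨j, rfl⟩)
  · exact hRO hz
  · -- `x_{e j} / x_{e i} ∈ O` since `v(x_{e j}) ≤ v(x_{e i})`
    by_cases h0 : (x (e i) : K) = 0
    · change (x (e j) : K) / (x (e i) : K) ∈ O
      rw [h0, div_zero]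
      exact O.zero_mem
    · change (x (e j) : K) / (x (e i) : K) ∈ O
      rw [← O.valuation_le_one_iff, map_div₀]
      exact div_le_one_of_le₀ (hmin j) zero_le

end Chart

end Literature.AlgebraicGeometry.Resolution

end
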